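import Literature.AlgebraicGeometry.Motives.GrassmannianSheaf
import Literature.AlgebraicGeometry.Motives.ZariskiSheafMorphismsOnAffines
import Mathlib.AlgebraicGeometry.Cover.Open
import HarnessLib

/-!
# A `T`-point of the Grassmannian is a compatible family of rank-`k` quotients on the affine opens of `T`

Topic `AlgebraicGeometry/Motives`; namespace `Literature.AlgebraicGeometry.Motives.Grassmannian`.  THEOREMS ONLY
(no definition, no instance, no notation, no named fact, no `sorry`).

The Grassmannian sheaf ★ `grassmannianSheaf M k : Sheaf Scheme.zariskiTopology (Type u)` ((D3) `GrassmannianSheaf`) is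
the extension to all schemes of the Grassmannian FUNCTOR `A ↦ G(k, A ⊗_ℤ M; A)` (Mathlib `Module.Grassmannian`) along the
comparison «Zariski sheaves on schemes = Zariski sheaves on affine schemes» (★ `ZariskiSheavesOnAffineSchemes`,
[GortzWedhorn2020, (8.4) and Exercise 8.1]); its sections over a NON-affine `T` are abstract, read on affine opens `V ⊆ T`
through ★ `evalAffine : Gr(T) → G(k, Γ(T, V) ⊗_ℤ M; Γ(T, V))`.  This file makes them concrete — the algebraic half of the
universal property of the Grassmannian scheme over an arbitrary base ([GortzWedhorn2020, (8.4) (pp. 213–215)]: «for an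
arbitrary scheme `S` … glue», EGA I (1971) 9.7.4):

* **`existsUnique_of_affineFamily`** — a family `N_V ∈ G(k, Γ(T, V) ⊗ M; Γ(T, V))` indexed by the affine opens `V` of
  `T` and COMPATIBLE WITH RESTRICTION TO BASIC OPENS (`N_{D(r)} = N_V ⊗_{Γ(V)} Γ(D(r))`, the form produced by localising
  a quotient module, ★ `map_toSubmodule_eq_localized'`) comes from a UNIQUE section `x ∈ Gr(T)` with `evalAffine V x = N_V`
  for every affine `V`.  Proof: the local sections `specEquiv⁻¹ N_V ∈ Gr(Spec Γ(T, V))` on the open cover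
  `{Spec Γ(T, V) ⟶ T}` of `T` by all its affine opens are compatible — tested, by ★ `sections_ext_of_openCover`, on the
  preimages of opens basic in two affine opens at once (Mathlib `exists_basicOpen_le_affine_inter`), through which both
  restrictions factor (`IsOpenImmersion.lift`, `IsAffineOpen.map_fromSpec`) — and glue by the sheaf axiom
  (`Presieve.isSheafFor_arrows_iff` for the cover sieve, Mathlib `Scheme.Cover.mem_grothendieckTopology`);
* **`ext_of_evalAffine`** — a section of `Gr` over any `T` is determined by its values on the affine opens;
* under `[(grassmannianSheaf M k).obj.IsRepresentable]` (★ (A4) `isRepresentable_grassmannianSheaf` for `M` free), for the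
  scheme ★ `grassmannianScheme M k` and ★ `pointsEquiv`: **`hom_ext_of_evalAffine`** and
  **`existsUnique_hom_of_affineFamily`** — morphisms `T ⟶ grassmannianScheme M k` ↔ compatible affine families of
  rank-`k` quotients (the form in which a rank-`k` locally free quotient `𝒪_T ⊗ M ↠ 𝒬` is classified, sequel FILE Q2).

Cell `hodgecm-mathlib` (D-0151), F-DAG hand (h4) «Grassmannian as a scheme» (B-p21 lineage), brick (Q1); count-neutral
Mathlib-side capital.  Nothing here is about HC; HC_CM is proved only modulo the 7 printed citations until rung 0 closes.

## References
* [GortzWedhorn2020] U. Görtz, T. Wedhorn, *Algebraic Geometry I*, 2nd ed. (2020), (8.4) (pp. 213–215), Ch. 8 Exercise 8.1;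
  (3.5) Prop. 3.10 (gluing of morphisms).
* [StacksProject] The Stacks project, Tag 089R (Grassmannians), Tag 020W (Zariski sheaves and affine schemes).
-/

namespace Literature.AlgebraicGeometry.Motives.Grassmannian

open CategoryTheory Opposite TensorProduct TopologicalSpace _root_.AlgebraicGeometry

universe u

variable (M : Type u) [AddCommGroup M] (k : ℕ)

/-- **Gluing: a family of rank-`k` quotients `N_V ∈ G(k, Γ(T, V) ⊗ M; Γ(T, V))` on the affine opens `V` of a scheme `T`,
compatible with restriction to basic opens, comes from a unique section of the Grassmannian sheaf over `T`.**
[cite: GortzWedhorn2020, (8.4) (pp. 213–215)] -/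
theorem existsUnique_of_affineFamily {T : Scheme.{u}}
    (N : ∀ V : T.affineOpens, Module.Grassmannian Γ(T, V) (Γ(T, V) ⊗[ℤ] M) k)
    (hN : ∀ (V : T.affineOpens) (r : Γ(T, V)),
      N ⟨T.basicOpen r, V.2.basicOpen r⟩ =
        Module.Grassmannian.map (T.presheaf.map (homOfLE (T.basicOpen_le r)).op).hom.toIntAlgHom (N V)) :
    ∃! x : (grassmannianSheaf M k).obj.obj (op T), ∀ V : T.affineOpens, evalAffine V.2 x = N V := by
  classical
  -- compatibility in the flexible form `W = D(r)` up to equality of opens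
  have hN' : ∀ (V W : T.affineOpens) (r : Γ(T, V)) (e : (W : T.Opens) = T.basicOpen r)
      (hle : (W : T.Opens) ≤ V),
      N W = Module.Grassmannian.map (T.presheaf.map (homOfLE hle).op).hom.toIntAlgHom (N V) := by
    rintro V ⟨W, hW⟩ r e hle
    subst e
    exact hN V r
  -- the open cover of `T` by the spectra of its affine opens
  let 𝒰 : T.OpenCover := Scheme.Cover.mkOfCovers T.affineOpens (fun V => Spec Γ(T, V)) (fun V => V.2.fromSpec)
    (fun x => by
      obtain ⟨V, hV, hxV, -⟩ := Opens.isBasis_iff_nbhd.mp T.isBasis_affineOpens (show x ∈ (⊤ : T.Opens) from trivial)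
      obtain ⟨y, hy⟩ : x ∈ Set.range (IsAffineOpen.fromSpec hV) := by
        rw [IsAffineOpen.range_fromSpec]
        exact hxV
      exact ⟨⟨V, hV⟩, y, hy⟩)
  -- the sheaf condition of `Gr` for `𝒰`
  have hsheaf := (Presieve.isSheafFor_iff_generate (Presieve.ofArrows 𝒰.X 𝒰.f)).mpr
    ((isSheaf_iff_isSheaf_of_type _ _).mp (grassmannianSheaf M k).property _ 𝒰.mem_grothendieckTopology)
  rw [Presieve.isSheafFor_arrows_iff] at hsheaf
  -- the local sections
  let xfam : ∀ V : T.affineOpens, (grassmannianSheaf M k).obj.obj (op (𝒰.X V)) :=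
    fun V => (specEquiv M k Γ(T, V)).symm (N V)
  -- restriction of a local section to a basic open
  have hres : ∀ (V W : T.affineOpens) (hle : (W : T.Opens) ≤ V),
      (grassmannianSheaf M k).obj.map (Spec.map (T.presheaf.map (homOfLE hle).op)).op (xfam V) =
        (specEquiv M k Γ(T, W)).symm
          (Module.Grassmannian.map (T.presheaf.map (homOfLE hle).op).hom.toIntAlgHom (N V)) := by
    intro V W hle
    apply (specEquiv M k Γ(T, W)).injective
    rw [specEquiv_naturality, Equiv.apply_symm_apply, Equiv.apply_symm_apply]
  -- compatibility of the local sections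
  have hcompat' : ∀ (i j : T.affineOpens) (Z : Scheme.{u}) (gi : Z ⟶ Spec Γ(T, i)) (gj : Z ⟶ Spec Γ(T, j)),
      gi ≫ i.2.fromSpec = gj ≫ j.2.fromSpec →
        (grassmannianSheaf M k).obj.map gi.op (xfam i) = (grassmannianSheaf M k).obj.map gj.op (xfam j) := by
    intro i j Z gi gj hg
    -- cover `Z` by preimages of opens basic in both `V_i` and `V_j`
    have hmem : ∀ z : Z, (gi ≫ i.2.fromSpec).base z ∈ (i : T.Opens) ⊓ (j : T.Opens) := by
      intro z
      constructor
      · rw [← IsAffineOpen.range_fromSpec i.2]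
        exact ⟨gi.base z, by simp⟩
      · rw [← IsAffineOpen.range_fromSpec j.2, show gi ≫ i.2.fromSpec = gj ≫ j.2.fromSpec from hg]
        exact ⟨gj.base z, by simp⟩
    choose f g e hf using fun z => exists_basicOpen_le_affine_inter i.2 j.2 _ (hmem z)
    let 𝒲 : Z.OpenCover := Scheme.Cover.mkOfCovers Z (fun z => ↑((gi ≫ i.2.fromSpec) ⁻¹ᵁ T.basicOpen (f z)))
      (fun z => ((gi ≫ i.2.fromSpec) ⁻¹ᵁ T.basicOpen (f z)).ι)
      (fun z => ⟨z, ⟨z, hf z⟩, rfl⟩)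
    refine sections_ext_of_openCover (F := grassmannianSheaf M k) 𝒲 fun z => ?_
    -- the common affine open `W = D(f z) = D(g z)`
    let W : T.affineOpens := ⟨T.basicOpen (f z), i.2.basicOpen (f z)⟩
    have hWi : (W : T.Opens) ≤ i := T.basicOpen_le (f z)
    have hWj : (W : T.Opens) ≤ j := by
      rw [show ((W : T.Opens)) = T.basicOpen (g z) from e z]
      exact T.basicOpen_le (g z)
    -- the member `Wz = g⁻¹(W)` of the cover factors through `Spec Γ(T, W)`
    let ι : (𝒲.X z) ⟶ Z := ((gi ≫ i.2.fromSpec) ⁻¹ᵁ T.basicOpen (f z)).ι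
    have hrange : Set.range (ι ≫ gi ≫ i.2.fromSpec).base ⊆ Set.range W.2.fromSpec.base := by
      rw [IsAffineOpen.range_fromSpec]
      rintro _ ⟨w, rfl⟩
      exact w.2
    let a : 𝒲.X z ⟶ Spec Γ(T, W) := IsOpenImmersion.lift W.2.fromSpec (ι ≫ gi ≫ i.2.fromSpec) hrange
    have ha : a ≫ W.2.fromSpec = ι ≫ gi ≫ i.2.fromSpec := IsOpenImmersion.lift_fac _ _ hrange
    have key_i : ι ≫ gi = a ≫ Spec.map (T.presheaf.map (homOfLE hWi).op) := by
      rw [← cancel_mono i.2.fromSpec, Category.assoc, Category.assoc, IsAffineOpen.map_fromSpec i.2 W.2, ha]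
    have key_j : ι ≫ gj = a ≫ Spec.map (T.presheaf.map (homOfLE hWj).op) := by
      rw [← cancel_mono j.2.fromSpec, Category.assoc, Category.assoc, IsAffineOpen.map_fromSpec j.2 W.2, ha,
        show gi ≫ i.2.fromSpec = gj ≫ j.2.fromSpec from hg]
    change (grassmannianSheaf M k).obj.map ι.op ((grassmannianSheaf M k).obj.map gi.op (xfam i)) =
      (grassmannianSheaf M k).obj.map ι.op ((grassmannianSheaf M k).obj.map gj.op (xfam j))
    rw [← Functor.map_comp_apply, ← Functor.map_comp_apply, ← op_comp, ← op_comp, key_i, key_j,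
      op_comp, op_comp, Functor.map_comp_apply, Functor.map_comp_apply, hres i W hWi, hres j W hWj,
      ← hN' i W (f z) rfl hWi, ← hN' j W (g z) (e z) hWj]
  have hcompat : Presieve.Arrows.Compatible (grassmannianSheaf M k).obj 𝒰.f xfam := hcompat'
  -- sections with the prescribed affine values restrict to the local sections
  have hfam : ∀ t : (grassmannianSheaf M k).obj.obj (op T), (∀ V : T.affineOpens, evalAffine V.2 t = N V) →
      ∀ V : T.affineOpens, (grassmannianSheaf M k).obj.map V.2.fromSpec.op t = xfam V := by
    intro t ht V
    apply (specEquiv M k Γ(T, V)).injective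
    rw [Equiv.apply_symm_apply]
    exact ht V
  obtain ⟨t, ht, huniq⟩ := hsheaf xfam hcompat
  have ht' : ∀ V : T.affineOpens, (grassmannianSheaf M k).obj.map V.2.fromSpec.op t = xfam V := ht
  refine ⟨t, fun V => ?_, fun t' h' => huniq t' (hfam t' h')⟩
  rw [evalAffine_def, ht' V, Equiv.apply_symm_apply]

/-- **A section of the Grassmannian sheaf over any scheme is determined by its values on the affine opens.**
[cite: GortzWedhorn2020, (8.4) (pp. 213–215)] -/
theorem ext_of_evalAffine {T : Scheme.{u}} {x y : (grassmannianSheaf M k).obj.obj (op T)}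
    (h : ∀ (V : T.Opens) (hV : IsAffineOpen V), evalAffine (M := M) (k := k) hV x = evalAffine hV y) : x = y := by
  obtain ⟨t, -, huniq⟩ := existsUnique_of_affineFamily M k (T := T) (fun V => evalAffine V.2 x)
    (fun V r => evalAffine_of_le V.2 (V.2.basicOpen r) (T.basicOpen_le r) x)
  exact (huniq x fun V => rfl).trans (huniq y fun V => (h V.1 V.2).symm).symm

section Scheme

variable [(grassmannianSheaf M k).obj.IsRepresentable]

/-- **Morphisms `T ⟶ grassmannianScheme M k` are determined by the quotients they induce on the affine opens of `T`.**
[cite: GortzWedhorn2020, (8.4) (pp. 213–215)] -/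
theorem hom_ext_of_evalAffine {T : Scheme.{u}} {f g : T ⟶ grassmannianScheme M k}
    (h : ∀ (V : T.Opens) (hV : IsAffineOpen V),
      evalAffine hV (pointsEquiv M k T f) = evalAffine hV (pointsEquiv M k T g)) : f = g :=
  (pointsEquiv M k T).injective (ext_of_evalAffine M k h)

/-- **Universal property of the Grassmannian scheme over an arbitrary base, algebraic form**: a family of rank-`k`
quotients `N_V ∈ G(k, Γ(T, V) ⊗ M; Γ(T, V))` on the affine opens of `T`, compatible with restriction to basic opens,
is induced by a unique morphism `T ⟶ grassmannianScheme M k`. [cite: GortzWedhorn2020, (8.4) (pp. 213–215)] -/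
theorem existsUnique_hom_of_affineFamily {T : Scheme.{u}}
    (N : ∀ V : T.affineOpens, Module.Grassmannian Γ(T, V) (Γ(T, V) ⊗[ℤ] M) k)
    (hN : ∀ (V : T.affineOpens) (r : Γ(T, V)),
      N ⟨T.basicOpen r, V.2.basicOpen r⟩ =
        Module.Grassmannian.map (T.presheaf.map (homOfLE (T.basicOpen_le r)).op).hom.toIntAlgHom (N V)) :
    ∃! f : T ⟶ grassmannianScheme M k, ∀ V : T.affineOpens, evalAffine V.2 (pointsEquiv M k T f) = N V := by
  obtain ⟨x, hx, huniq⟩ := existsUnique_of_affineFamily M k N hN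
  refine ⟨(pointsEquiv M k T).symm x, fun V => by rw [Equiv.apply_symm_apply]; exact hx V, fun f hf => ?_⟩
  rw [Equiv.eq_symm_apply]
  exact huniq _ hf

end Scheme

end Literature.AlgebraicGeometry.Motives.Grassmannian
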